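import Mathlib

/-!
# Crux `MatrixDescartes` (stmt-ValiantsHypothesis-18050), line `rolle-schur-residual` —
# FIRST STUB `stub_rolleSchurStep : RolleSchurStep` (the Rolle–Schur step), PROVED

Line file: `Summits/ValiantsHypothesis/ValiantsHypothesis/Cruxes/MatrixDescartes/Lines/rolle_schur_residual.lean`
(ideator val-idea-3, card `Cruxes/MatrixDescartes/Ideas/rolle-schur-residual.md`), stub K1.
The statement `rolleSchurStep` below is the line's Prop `RolleSchurStep` with the line's local
vocabulary (`pencil`, `shifted`, `adjVec`, `compDet`, `residual`, `posRoots`) UNFOLDED to Mathlib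
terms (the line file lives under `Cruxes/` and carries `sorry`s, so it cannot be imported); the two
statements agree definitionally, so the line closes its stub by `exact RolleSchur.rolleSchurStep`
(checked against a verbatim copy of the line's definitions before landing).

**Statement (all formats `(m, K)`, all exponent vectors).**  Let `F = ∑ₗ X^{dₗ} Sₗ` be a lacunary
pencil with real symmetric `m × m` letters, `w : Fin m → ℝ`, `e : ℝ`; put `u = adj(F) w`,
`a = wᵀ adj(F) w`, `M_e = ∑ₗ (dₗ − e) X^{dₗ} Sₗ` (`= X F′ − e F`) and `P = uᵀ M_e u`.  If
`det F ≢ 0` then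
`Z₊(det F) ≤ Z₊(P) + Z₊(a) + 1 + #{x > 0 : det F(x) = 0 ∧ a(x) = 0}`,
`Z₊` = number of distinct positive roots (none for the zero polynomial).  The stub's hypothesis
`a ≢ 0` is carried but not used.

**Proof.**  §3 (algebra, any square polynomial matrix): differentiating `F·adj F = f • 1`
(`f = det F`) and multiplying by `adj F` on the left gives the sandwich identity
`adj F · F′ · adj F = f′ • adj F − f • (adj F)′` (no Jacobi formula needed); with `F` symmetric
this yields (I1) `uᵀ F u = f·a`, (I2) `uᵀ F′ u = f′a − f a′`, hence (I3) the residual identity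
`P = X·(f′a − fa′) − e·fa` — a polynomial identity, the real shift `e` never enters an exponent.
§2 (analysis, scalar): on `(0, ∞)` off the zeros of `a`, `(x^{−e} f/a)′ = x^{−e−1} P/a²`, so by
Rolle (`exists_hasDerivAt_eq_zero`) any two positive zeros `x < y` of `f` with `a ≠ 0` on `[x, y]`
are separated by a root of `P`; and `P ≢ 0` there unless `f ≡ 0` (mean value theorem +
`Polynomial.eq_zero_of_infinite_isRoot`).  Hence any two positive zeros of `f` off the zero set of
`a` are separated by a positive zero of `a` or of `P`, and §1 (`card_le_card_add_one_of_separated`,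
induction on the minimum) gives `#{f = 0, a ≠ 0, x > 0} ≤ Z₊(P) + Z₊(a) + 1`.

Sources: Rolle's theorem and the adjugate identities `F·adj F = adj F·F = det F • 1`
(Mathlib `Matrix.mul_adjugate`, `Matrix.adjugate_mul`, `Matrix.adjugate_transpose`); the
divide-and-differentiate count is the classical Descartes/Pólya–Szegő argument for exponential sums
[corpus:book:braess1986-nonlinear-approximation-theory pp 170–182] (the `m = 1` case, cited by the
card); the rank-one/Schur reading of `a = ‖w‖² det F_{w⊥}` is [corpus:book:horn2012-matrix-analysis
p 735] and is NOT used here (it belongs to the telescope stub).  Elementary; Mathlib only; axioms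
`propext`, `Classical.choice`, `Quot.sound`.

Honest framing: an M-sized SUPPORT stub (identity + Rolle) of a registered line of the V1 crux,
instrument/structure tier.  It is an exact count that cannot fail; the line's law
(`stub_residualLaw`, XL) and telescope (`stub_telescope`) are untouched here; the crux
`LacunarySymmetroid.MatrixDescartes`, Conjecture B (`KPlusLogSqLaw`) and rung V1 do NOT move;
`VP ≠ VNP` is NOT proved and nothing here is progress on it.  No definitions, no named facts.
-/

-- `Summit.ValiantsHypothesis.ValiantsHypothesis.…` is the tree's mandated single-conjunct layout
-- (Sub = Summit), so the duplicated namespace component is intended.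
set_option linter.dupNamespace false
set_option autoImplicit false

namespace Summit.ValiantsHypothesis.ValiantsHypothesis.Theorems.LacunarySymmetroidMatrixDescartes

open Polynomial Matrix Finset
open scoped BigOperators

namespace RolleSchur

/-! ## §1 Combinatorics: a finite set whose gaps are all marked -/

/-- If any two points `x < y` of a finite set `T` in a linear order are separated by a point of
`U` lying strictly between them, then `#T ≤ #U + 1` (remove the minimum of `T` and the marker of
its first gap, induct). [folklore] -/
theorem card_le_card_add_one_of_separated {α : Type*} [LinearOrder α] (T U : Finset α)
    (h : ∀ x ∈ T, ∀ y ∈ T, x < y → ∃ u ∈ U, x < u ∧ u < y) : T.card ≤ U.card + 1 := by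
  classical
  revert U
  refine Finset.induction_on_min T ?_ ?_
  · intro U _
    simp
  · intro b s hb ih U h
    rcases s.eq_empty_or_nonempty with hs | hs
    · subst hs
      simp
    · have hb's : s.min' hs ∈ s := s.min'_mem hs
      obtain ⟨u, huU, -, hub'⟩ :=
        h b (Finset.mem_insert_self b s) (s.min' hs) (Finset.mem_insert_of_mem hb's) (hb _ hb's)
      have ih' := ih (U.erase u) (by
        intro x hx y hy hxy
        obtain ⟨u', hu'U, hxu', hu'y⟩ :=
          h x (Finset.mem_insert_of_mem hx) y (Finset.mem_insert_of_mem hy) hxy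
        have hb'x : s.min' hs ≤ x := s.min'_le x hx
        exact ⟨u', Finset.mem_erase.mpr ⟨(hub'.trans_le (hb'x.trans hxu'.le)).ne', hu'U⟩,
          hxu', hu'y⟩)
      have hcard : (U.erase u).card + 1 = U.card := Finset.card_erase_add_one huU
      have hbs : b ∉ s := fun hmem => lt_irrefl b (hb b hmem)
      rw [Finset.card_insert_of_notMem hbs]
      omega

/-! ## §2 The scalar Rolle step for the twisted quotient `x^{-e} · f / a` -/

/-- **Rolle for the operator `x·d/dx − e` on a gap.**  Let `f, a` be real polynomials, `f ≠ 0`,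
`e` real, and `0 < x < y` two zeros of `f` such that `a` has no zero on `[x, y]`.  Then the
residual `P = X·(f′a − fa′) − e·fa` (which is `a² x^{e+1} · (x^{-e} f/a)′` on `(0, ∞)`) has a
root in `(x, y)` and is not the zero polynomial (if it were, `x^{-e} f/a` would be constant,
hence `f ≡ 0` near `x`). [folklore] -/
theorem exists_mem_roots_residual_of_gap (f a : ℝ[X]) (e : ℝ) (hf : f ≠ 0) {x y : ℝ}
    (hx : 0 < x) (hxy : x < y) (hfx : f.eval x = 0) (hfy : f.eval y = 0)
    (ha : ∀ t ∈ Set.Icc x y, a.eval t ≠ 0) :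
    ∃ c ∈ Set.Ioo x y,
      c ∈ (X * (derivative f * a - f * derivative a) - C e * (f * a)).roots := by
  set P : ℝ[X] := X * (derivative f * a - f * derivative a) - C e * (f * a) with hP
  set r : ℝ → ℝ := fun t => t ^ (-e) * (f.eval t / a.eval t) with hr
  -- the derivative of the twisted quotient is `t^{-e-1} · P(t) / a(t)²`
  have hderiv : ∀ t, 0 < t → a.eval t ≠ 0 →
      HasDerivAt r (t ^ (-e - 1) / (a.eval t) ^ 2 * P.eval t) t := by
    intro t ht hat
    have h1 : HasDerivAt (fun s : ℝ => s ^ (-e)) ((-e) * t ^ (-e - 1)) t :=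
      Real.hasDerivAt_rpow_const (Or.inl ht.ne')
    have h2 : HasDerivAt (fun s => f.eval s / a.eval s)
        (((derivative f).eval t * a.eval t - f.eval t * (derivative a).eval t) / (a.eval t) ^ 2) t :=
      (f.hasDerivAt t).div (a.hasDerivAt t) hat
    refine (h1.mul h2).congr_deriv ?_
    have hte : t ^ (-e) = t ^ (-e - 1) * t := by
      rw [← Real.rpow_add_one ht.ne']
      ring_nf
    simp only [hP, eval_sub, eval_mul, eval_X, eval_C]
    rw [hte]
    field_simp
    ring
  have hcont : ContinuousOn r (Set.Icc x y) := fun t ht =>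
    (hderiv t (hx.trans_le ht.1) (ha t ht)).continuousAt.continuousWithinAt
  have hrx : r x = 0 := by simp [hr, hfx]
  have hry : r y = 0 := by simp [hr, hfy]
  obtain ⟨c, hc, hc0⟩ := exists_hasDerivAt_eq_zero hxy hcont (hrx.trans hry.symm)
    (fun t ht => hderiv t (hx.trans ht.1) (ha t (Set.Ioo_subset_Icc_self ht)))
  have hc_pos : 0 < c := hx.trans hc.1
  have hac : a.eval c ≠ 0 := ha c (Set.Ioo_subset_Icc_self hc)
  have hPc : P.eval c = 0 := by
    have h1 : c ^ (-e - 1) / (a.eval c) ^ 2 ≠ 0 :=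
      div_ne_zero (Real.rpow_pos_of_pos hc_pos _).ne' (pow_ne_zero 2 hac)
    rcases mul_eq_zero.mp hc0 with h | h
    · exact absurd h h1
    · exact h
  by_cases hP0 : P = 0
  · -- degenerate case: `r′ ≡ 0` on `(x, y)`, so `r ≡ r x = 0` there and `f` vanishes on `(x, y)`
    exfalso
    apply hf
    apply Polynomial.eq_zero_of_infinite_isRoot
    refine Set.Infinite.mono ?_ (Set.Ioo_infinite hxy)
    intro t ht
    have ht' : x < t ∧ t < y := ht
    have ht0 : 0 < t := hx.trans ht'.1
    have hat : a.eval t ≠ 0 := ha t (Set.Ioo_subset_Icc_self ht)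
    obtain ⟨ξ, -, hξeq⟩ := exists_hasDerivAt_eq_slope r
      (fun s => s ^ (-e - 1) / (a.eval s) ^ 2 * P.eval s) ht'.1
      (hcont.mono (Set.Icc_subset_Icc_right ht'.2.le))
      (fun s hs => hderiv s (hx.trans hs.1) (ha s ⟨hs.1.le, hs.2.le.trans ht'.2.le⟩))
    have hslope : (r t - r x) / (t - x) = 0 := by
      rw [← hξeq, hP0, eval_zero, mul_zero]
    have htx : t - x ≠ 0 := sub_ne_zero.mpr ht'.1.ne'
    have hrt : r t = 0 := by
      rcases div_eq_zero_iff.mp hslope with h | h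
      · rwa [hrx, sub_zero] at h
      · exact absurd h htx
    have hte : (t : ℝ) ^ (-e) ≠ 0 := (Real.rpow_pos_of_pos ht0 _).ne'
    have hft : f.eval t = 0 := by
      rcases mul_eq_zero.mp hrt with h | h
      · exact absurd h hte
      · rcases div_eq_zero_iff.mp h with h | h
        · exact h
        · exact absurd h hat
    exact hft
  · exact ⟨c, hc, (Polynomial.mem_roots hP0).mpr hPc⟩

/-- **Scalar Rolle–Schur count.**  For real polynomials `f ≠ 0` and `a`, and a real `e`, with
`P = X·(f′a − fa′) − e·fa`:
`Z₊(f) ≤ Z₊(P) + Z₊(a) + 1 + #{t > 0 : f(t) = 0 ∧ a(t) = 0}`,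
where `Z₊` counts distinct positive roots (none for the zero polynomial).  Proof: the positive
roots of `f` off the zero set of `a` form a set any two of whose points are separated by a positive
root of `a` or, failing that, by a root of `P` (`exists_mem_roots_residual_of_gap`); conclude with
`card_le_card_add_one_of_separated`. [folklore] -/
theorem posRoots_le_scalar (f a : ℝ[X]) (e : ℝ) (hf : f ≠ 0) :
    (f.roots.toFinset.filter (fun x => 0 < x)).card ≤
      ((X * (derivative f * a - f * derivative a) - C e * (f * a)).roots.toFinset.filter
          (fun x => 0 < x)).card +
        (a.roots.toFinset.filter (fun x => 0 < x)).card + 1 +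
        (f.roots.toFinset.filter (fun x => 0 < x ∧ a.IsRoot x)).card := by
  classical
  set P : ℝ[X] := X * (derivative f * a - f * derivative a) - C e * (f * a) with hP
  set Zf := f.roots.toFinset.filter (fun x => 0 < x) with hZf
  set T := Zf.filter (fun x => ¬ a.IsRoot x) with hT
  set U := (P.roots.toFinset.filter (fun x => 0 < x)) ∪ (a.roots.toFinset.filter (fun x => 0 < x))
    with hU
  -- split the positive roots of `f` along the zero set of `a`
  have hsplit : Zf.card = T.card + (f.roots.toFinset.filter (fun x => 0 < x ∧ a.IsRoot x)).card := by
    have h1 := Finset.card_filter_add_card_filter_not (s := Zf) (fun x => a.IsRoot x)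
    have h2 : Zf.filter (fun x => a.IsRoot x) =
        f.roots.toFinset.filter (fun x => 0 < x ∧ a.IsRoot x) := by
      rw [hZf, Finset.filter_filter]
    rw [← h2, hT]
    omega
  -- every gap of `T` is marked by a point of `U`
  have hsep : ∀ x ∈ T, ∀ y ∈ T, x < y → ∃ u ∈ U, x < u ∧ u < y := by
    intro x hx y hy hxy
    simp only [hT, hZf, Finset.mem_filter, Multiset.mem_toFinset] at hx hy
    obtain ⟨⟨hfx, hx0⟩, hax⟩ := hx
    obtain ⟨⟨hfy, -⟩, hay⟩ := hy
    by_cases hgap : ∃ u ∈ a.roots.toFinset.filter (fun x => 0 < x), x < u ∧ u < y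
    · obtain ⟨u, hu, hxu, huy⟩ := hgap
      exact ⟨u, Finset.mem_union_right _ hu, hxu, huy⟩
    · have ha : ∀ t ∈ Set.Icc x y, a.eval t ≠ 0 := by
        intro t ht hat
        have ha0 : a ≠ 0 := by
          rintro rfl
          exact hax (by simp)
        have htx : t ≠ x := by
          rintro rfl
          exact hax hat
        have hty : t ≠ y := by
          rintro rfl
          exact hay hat
        refine hgap ⟨t, ?_, lt_of_le_of_ne ht.1 (Ne.symm htx), lt_of_le_of_ne ht.2 hty⟩
        simp only [Finset.mem_filter, Multiset.mem_toFinset]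
        exact ⟨(Polynomial.mem_roots ha0).mpr hat, hx0.trans_le ht.1⟩
      have hfx' : f.eval x = 0 := ((Polynomial.mem_roots hf).mp hfx)
      have hfy' : f.eval y = 0 := ((Polynomial.mem_roots hf).mp hfy)
      obtain ⟨c, hc, hcP⟩ := exists_mem_roots_residual_of_gap f a e hf hx0 hxy hfx' hfy' ha
      refine ⟨c, Finset.mem_union_left _ ?_, hc.1, hc.2⟩
      simp only [Finset.mem_filter, Multiset.mem_toFinset]
      exact ⟨hcP, hx0.trans hc.1⟩
  have hTU := card_le_card_add_one_of_separated T U hsep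
  have hUle : U.card ≤ (P.roots.toFinset.filter (fun x => 0 < x)).card +
      (a.roots.toFinset.filter (fun x => 0 < x)).card := Finset.card_union_le _ _
  omega

/-! ## §3 Matrix calculus over `ℝ[X]`: the adjugate identities -/

section MatrixCalculus

/-- Leibniz rule for the entrywise derivative of a product of polynomial matrices. [folklore] -/
theorem map_derivative_mul {n : Type*} [Fintype n] (A B : Matrix n n ℝ[X]) :
    (A * B).map (⇑derivative) = A.map (⇑derivative) * B + A * B.map (⇑derivative) := by
  ext i j
  simp only [Matrix.map_apply, Matrix.mul_apply, Matrix.add_apply, derivative_sum, derivative_mul,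
    Finset.sum_add_distrib]

/-- Entrywise derivative of a scalar matrix `f • 1`. [folklore] -/
theorem map_derivative_smul_one {n : Type*} [DecidableEq n] (f : ℝ[X]) :
    (f • (1 : Matrix n n ℝ[X])).map (⇑derivative) = derivative f • (1 : Matrix n n ℝ[X]) := by
  ext i j
  by_cases hij : i = j
  · simp [hij]
  · simp [hij]

/-- **Adjugate sandwich identity.**  For a square polynomial matrix `F` with `f = det F`:
`adj(F) · F′ · adj(F) = f′ • adj(F) − f • adj(F)′` — obtained by differentiating
`F · adj(F) = f • 1` and multiplying by `adj(F)` on the left (no Jacobi formula needed). [folklore] -/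
theorem adjugate_mul_map_derivative_mul_adjugate {n : Type*} [Fintype n] [DecidableEq n]
    (F : Matrix n n ℝ[X]) :
    F.adjugate * F.map (⇑derivative) * F.adjugate =
      derivative F.det • F.adjugate - F.det • F.adjugate.map (⇑derivative) := by
  have h1 : (F * F.adjugate).map (⇑derivative) =
      (F.det • (1 : Matrix n n ℝ[X])).map (⇑derivative) := by
    rw [Matrix.mul_adjugate]
  rw [map_derivative_mul, map_derivative_smul_one] at h1
  have h2 := congrArg (fun M => F.adjugate * M) h1
  rw [Matrix.mul_add, ← Matrix.mul_assoc, ← Matrix.mul_assoc, Matrix.adjugate_mul, Matrix.smul_mul,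
    Matrix.one_mul, Matrix.mul_smul, Matrix.mul_one] at h2
  exact eq_sub_of_add_eq h2

/-- For a symmetric matrix `A`: `(A v) · x = v · (A x)`. [folklore] -/
theorem mulVec_dotProduct_of_isSymm {n : Type*} [Fintype n] {A : Matrix n n ℝ[X]} (hA : A.IsSymm)
    (v x : n → ℝ[X]) :
    (A *ᵥ v) ⬝ᵥ x = v ⬝ᵥ (A *ᵥ x) := by
  rw [Matrix.dotProduct_mulVec, ← Matrix.vecMul_transpose, hA.eq]

/-- The adjugate of a symmetric matrix is symmetric. [folklore] -/
theorem isSymm_adjugate {n : Type*} [Fintype n] [DecidableEq n] {A : Matrix n n ℝ[X]}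
    (hA : A.IsSymm) : A.adjugate.IsSymm := by
  unfold Matrix.IsSymm
  rw [Matrix.adjugate_transpose, hA.eq]

/-- **(I1)** With `u = adj(F) v`: `uᵀ F u = det F · (vᵀ adj(F) v)`. [folklore] -/
theorem adjVec_dotProduct_mulVec {n : Type*} [Fintype n] [DecidableEq n] (F : Matrix n n ℝ[X])
    (v : n → ℝ[X]) :
    (F.adjugate *ᵥ v) ⬝ᵥ (F *ᵥ (F.adjugate *ᵥ v)) = F.det * (v ⬝ᵥ (F.adjugate *ᵥ v)) := by
  rw [Matrix.mulVec_mulVec, Matrix.mul_adjugate, Matrix.smul_mulVec, Matrix.one_mulVec,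
    dotProduct_smul, smul_eq_mul, dotProduct_comm]

/-- **(I2)** With `u = adj(F) v`, `F` symmetric, `a = vᵀ adj(F) v`:
`uᵀ F′ u = (det F)′ · a − det F · vᵀ adj(F)′ v`. [folklore] -/
theorem adjVec_dotProduct_map_derivative_mulVec {n : Type*} [Fintype n] [DecidableEq n]
    (F : Matrix n n ℝ[X]) (hF : F.IsSymm) (v : n → ℝ[X]) :
    (F.adjugate *ᵥ v) ⬝ᵥ (F.map (⇑derivative) *ᵥ (F.adjugate *ᵥ v)) =
      derivative F.det * (v ⬝ᵥ (F.adjugate *ᵥ v)) -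
        F.det * (v ⬝ᵥ (F.adjugate.map (⇑derivative) *ᵥ v)) := by
  rw [mulVec_dotProduct_of_isSymm (isSymm_adjugate hF), Matrix.mulVec_mulVec, Matrix.mulVec_mulVec,
    adjugate_mul_map_derivative_mul_adjugate, Matrix.sub_mulVec, dotProduct_sub, Matrix.smul_mulVec,
    Matrix.smul_mulVec, dotProduct_smul, dotProduct_smul, smul_eq_mul, smul_eq_mul]

/-- Derivative of the quadratic form `vᵀ A v` for a constant vector `v`. [folklore] -/
theorem derivative_dotProduct_mulVec {n : Type*} [Fintype n] (A : Matrix n n ℝ[X])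
    (v : n → ℝ[X]) (hv : ∀ i, derivative (v i) = 0) :
    derivative (v ⬝ᵥ (A *ᵥ v)) = v ⬝ᵥ (A.map (⇑derivative) *ᵥ v) := by
  simp only [dotProduct, Matrix.mulVec, Matrix.map_apply, derivative_sum, derivative_mul, hv,
    zero_mul, zero_add, mul_zero, add_zero]

/-- **(I3) The residual identity.**  For a symmetric polynomial matrix `F` with `f = det F`, a
constant vector `v`, `u = adj(F) v`, `a = vᵀ adj(F) v` and a real shift `e`:
`uᵀ (X F′ − e F) u = X·(f′a − fa′) − e·fa`. [folklore] -/
theorem residual_eq {n : Type*} [Fintype n] [DecidableEq n] (F : Matrix n n ℝ[X])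
    (hF : F.IsSymm) (v : n → ℝ[X]) (hv : ∀ i, derivative (v i) = 0) (e : ℝ) :
    (F.adjugate *ᵥ v) ⬝ᵥ (((X : ℝ[X]) • F.map (⇑derivative) - C e • F) *ᵥ (F.adjugate *ᵥ v)) =
      X * (derivative F.det * (v ⬝ᵥ (F.adjugate *ᵥ v)) -
          F.det * derivative (v ⬝ᵥ (F.adjugate *ᵥ v))) -
        C e * (F.det * (v ⬝ᵥ (F.adjugate *ᵥ v))) := by
  rw [Matrix.sub_mulVec, dotProduct_sub, Matrix.smul_mulVec, Matrix.smul_mulVec, dotProduct_smul,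
    dotProduct_smul, smul_eq_mul, smul_eq_mul, adjVec_dotProduct_map_derivative_mulVec F hF v,
    adjVec_dotProduct_mulVec F v, derivative_dotProduct_mulVec _ v hv]

/-- **Matrix Rolle–Schur step (general form).**  For a symmetric square matrix `F` over `ℝ[X]`
with `det F ≠ 0`, a constant vector `v`, `u = adj(F) v`, `a = vᵀ adj(F) v` and any real `e`:
`Z₊(det F) ≤ Z₊(uᵀ(X F′ − e F)u) + Z₊(a) + 1 + #{t > 0 : det F(t) = 0 = a(t)}`. [folklore] -/
theorem posRoots_det_le {n : Type*} [Fintype n] [DecidableEq n] (F : Matrix n n ℝ[X])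
    (hF : F.IsSymm) (v : n → ℝ[X]) (hv : ∀ i, derivative (v i) = 0) (e : ℝ) (hdet : F.det ≠ 0) :
    (F.det.roots.toFinset.filter (fun x => 0 < x)).card ≤
      (((F.adjugate *ᵥ v) ⬝ᵥ (((X : ℝ[X]) • F.map (⇑derivative) - C e • F) *ᵥ
          (F.adjugate *ᵥ v))).roots.toFinset.filter (fun x => 0 < x)).card +
        ((v ⬝ᵥ (F.adjugate *ᵥ v)).roots.toFinset.filter (fun x => 0 < x)).card + 1 +
        (F.det.roots.toFinset.filter
          (fun x => 0 < x ∧ (v ⬝ᵥ (F.adjugate *ᵥ v)).IsRoot x)).card := by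
  rw [residual_eq F hF v hv e]
  exact posRoots_le_scalar F.det _ e hdet

end MatrixCalculus

/-! ## §4 The lacunary symmetric pencil: the line's stub `RolleSchurStep`, unfolded -/

/-- `X · (X^k)′ = k · X^k`. [folklore] -/
theorem X_mul_derivative_X_pow (k : ℕ) :
    (X : ℝ[X]) * derivative ((X : ℝ[X]) ^ k) = C (k : ℝ) * X ^ k := by
  rcases k with _ | k
  · simp
  · rw [derivative_X_pow_succ, pow_succ]
    push_cast
    ring

/-- The lacunary pencil `∑ₗ X^{dₗ} Sₗ` with symmetric letters is a symmetric polynomial matrix.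
[folklore] -/
theorem pencil_isSymm {m K : ℕ} (d : Fin K → ℕ) (S : Fin K → Matrix (Fin m) (Fin m) ℝ)
    (hS : ∀ l, (S l).IsSymm) : (∑ l, ((X : ℝ[X]) ^ d l) • (S l).map C).IsSymm := by
  unfold Matrix.IsSymm
  rw [Matrix.transpose_sum]
  exact Finset.sum_congr rfl fun l _ => by
    rw [Matrix.transpose_smul, ← Matrix.transpose_map, (hS l).eq]

/-- The shifted pencil is `X F′ − e F`: `∑ₗ (dₗ − e) X^{dₗ} Sₗ = X • F′ − e • F`. [folklore] -/
theorem shifted_eq {m K : ℕ} (d : Fin K → ℕ) (S : Fin K → Matrix (Fin m) (Fin m) ℝ) (e : ℝ) :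
    (∑ l, (C ((d l : ℝ) - e) * (X : ℝ[X]) ^ d l) • (S l).map C) =
      (X : ℝ[X]) • (∑ l, ((X : ℝ[X]) ^ d l) • (S l).map C).map (⇑derivative) -
        C e • ∑ l, ((X : ℝ[X]) ^ d l) • (S l).map C := by
  refine Matrix.ext fun i j => ?_
  simp only [Matrix.sum_apply, Matrix.smul_apply, Matrix.map_apply, Matrix.sub_apply, smul_eq_mul]
  rw [derivative_sum, Finset.mul_sum, Finset.mul_sum, ← Finset.sum_sub_distrib]
  refine Finset.sum_congr rfl fun l _ => ?_
  rw [derivative_mul, derivative_C, mul_zero, add_zero, ← mul_assoc, X_mul_derivative_X_pow, map_sub]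
  ring

/-- **The Rolle–Schur step** — the line's stub `stub_rolleSchurStep : RolleSchurStep`
(`Cruxes/MatrixDescartes/Lines/rolle_schur_residual.lean`) with the line's vocabulary
(`pencil`, `shifted`, `adjVec`, `compDet`, `residual`, `posRoots`) UNFOLDED, so that the line
closes the stub by `exact rolleSchurStep`.  For every lacunary pencil `F = ∑ₗ X^{dₗ} Sₗ` with real
symmetric letters, every `w : Fin m → ℝ` and real `e`, with `u = adj(F) w`, `a = wᵀ adj(F) w`,
`M_e = ∑ₗ (dₗ − e) X^{dₗ} Sₗ` and `P = uᵀ M_e u`: if `det F ≢ 0` then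
`Z₊(det F) ≤ Z₊(P) + Z₊(a) + 1 + #{x > 0 : det F(x) = 0 ∧ a(x) = 0}`.
(The hypothesis `a ≢ 0` of the stub is not needed.) [folklore] -/
theorem rolleSchurStep (m K : ℕ) (d : Fin K → ℕ) (S : Fin K → Matrix (Fin m) (Fin m) ℝ)
    (w : Fin m → ℝ) (e : ℝ) (hS : ∀ l, (S l).IsSymm)
    (_ha : (fun i => C (w i)) ⬝ᵥ
        (∑ l, ((X : ℝ[X]) ^ d l) • (S l).map C).adjugate.mulVec (fun i => C (w i)) ≠ 0)
    (hdet : (∑ l, ((X : ℝ[X]) ^ d l) • (S l).map C).det ≠ 0) :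
    ((∑ l, ((X : ℝ[X]) ^ d l) • (S l).map C).det.roots.toFinset.filter (fun x => 0 < x)).card ≤
      (((∑ l, ((X : ℝ[X]) ^ d l) • (S l).map C).adjugate.mulVec (fun i => C (w i)) ⬝ᵥ
            (∑ l, (C ((d l : ℝ) - e) * (X : ℝ[X]) ^ d l) • (S l).map C).mulVec
              ((∑ l, ((X : ℝ[X]) ^ d l) • (S l).map C).adjugate.mulVec (fun i => C (w i)))
          ).roots.toFinset.filter (fun x => 0 < x)).card +
        (((fun i => C (w i)) ⬝ᵥ
            (∑ l, ((X : ℝ[X]) ^ d l) • (S l).map C).adjugate.mulVec (fun i => C (w i))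
          ).roots.toFinset.filter (fun x => 0 < x)).card + 1 +
        ((∑ l, ((X : ℝ[X]) ^ d l) • (S l).map C).det.roots.toFinset.filter
          (fun x => 0 < x ∧ ((fun i => C (w i)) ⬝ᵥ
            (∑ l, ((X : ℝ[X]) ^ d l) • (S l).map C).adjugate.mulVec
              (fun i => C (w i))).IsRoot x)).card := by
  rw [shifted_eq d S e]
  exact posRoots_det_le _ (pencil_isSymm d S hS) _ (fun i => derivative_C) e hdet

end RolleSchur

end Summit.ValiantsHypothesis.ValiantsHypothesis.Theorems.LacunarySymmetroidMatrixDescartes
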